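import Summits.QuantumAdvantage.QuantumAdvantage.Theorems.CompositeFrameBound.Negative.LoadBearing
import Summits.QuantumAdvantage.QuantumAdvantage.Theorems.SymplecticPurityGaussianDegreeBoundSpectralMass
import Summits.QuantumAdvantage.QuantumAdvantage.Theorems.SymplecticPuritySymplecticPurityBoundPauli
import Summits.QuantumAdvantage.QuantumAdvantage.Theorems.SymplecticPurityNoFreeFramePurity
import Summits.QuantumAdvantage.QuantumAdvantage.Theorems.SymplecticPurityCubeGraphFlat

/-!
# `SymplecticPurity.CompositeFrameBound` (stmt-QuantumAdvantage-10730) — depth-1 RIGIDITY of the cube state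

Helper file (prover, line `Sketch`, `--supports stmt-QuantumAdvantage-10730`; ingredient (R) of the
TORUS THEOREM, `Cruxes/CompositeFrameBound/TorusTheorem.md`; the statement is refuter gen-2's
"depth-1 rigidity", `Cruxes/CompositeFrameBound/Disproof.lean` §6.1, here PROVED).  For every
CLIFFORD unitary `V` on the `2n` wires and EVERY cut `k ≤ 2n`,

  `‖Tr ρ²_{wires<k}(V ĝ)‖ ≤ 2^{-k} + 4·2^{-n} + 4·2^k/4^n`   (`rg_norm_cutPurity_clifford_ghat_le`),

(= `9·2⁻ⁿ` at `k = n`).  Purity = spectral mass (`gdb_norm_cutSum_eq`); Clifford pull-back of the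
`4^k` cut strings (`sum_stringsOn_norm_exp_sq_clifford`); on `ĝ`, X/Y-containing strings are
`≤ 2/2ⁿ` (APN, `card_cube_graph_pairs_le_two`) and Z-type ones `≤ 2/√2ⁿ` (`cubeGraphFlat_main`);
the Z-type pulled-back strings are `≤ 2^k`, read through the stabilizer state `V e₀` and
`purity ≤ ‖ψ‖⁴` (`rg_norm_cutPurity_le`).
-/

set_option linter.dupNamespace false -- D-0017: single-problem summit ⇒ `QuantumAdvantage.QuantumAdvantage` by design

noncomputable section

namespace Summit.QuantumAdvantage.QuantumAdvantage.Theorems.SymplecticPurity.CompositeFrameBound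

open Literature.Computability.Cryptography Literature.Computability.QuantumComplexity Matrix Finset
open Summit.QuantumAdvantage.QuantumAdvantage.Theorems.SymplecticPurity
open Summit.QuantumAdvantage.QuantumAdvantage.Theorems.CompositeFrameBound.Negative

variable {N : ℕ}

/-! ## Purity is at most `‖ψ‖⁴` -/

/-- Merging two labels along the cut: low wires from `u`, high wires from `v`. -/
def rgMerge (k : ℕ) (u v : QReg N) : QReg N := fun i => if i.val < k then u i else v i

/-- `rgMerge` on the low wires. -/
theorem rgMerge_low {k : ℕ} (u v : QReg N) {i : Fin N} (hi : i.val < k) : rgMerge k u v i = u i := by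
  simp [rgMerge, hi]

/-- `rgMerge` on the high wires. -/
theorem rgMerge_high {k : ℕ} (u v : QReg N) {i : Fin N} (hi : k ≤ i.val) : rgMerge k u v i = v i := by
  simp [rgMerge, Nat.not_lt.2 hi]

/-- The agreement conditions on `x₂` (given `x₁, x₃`) single out `x₂ = rgMerge k x₃ x₁`. -/
theorem rg_agree₂_iff (k : ℕ) (x₁ x₂ x₃ : QReg N) :
    ((∀ i : Fin N, k ≤ i.val → x₁ i = x₂ i) ∧ (∀ i : Fin N, i.val < k → x₂ i = x₃ i)) ↔
      x₂ = rgMerge k x₃ x₁ := by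
  constructor
  · rintro ⟨h1, h2⟩
    funext i
    by_cases hi : i.val < k
    · rw [rgMerge_low _ _ hi, h2 i hi]
    · rw [rgMerge_high _ _ (Nat.le_of_not_lt hi), h1 i (Nat.le_of_not_lt hi)]
  · rintro rfl
    exact ⟨fun i hi => (rgMerge_high _ _ hi).symm, fun i hi => rgMerge_low _ _ hi⟩

/-- The 4-fold agreement sum collapses to a 2-fold sum over `(x₁, x₃)`. -/
theorem rg_cutPurity_eq_two_fold (ψ : QReg N → ℂ) (k : ℕ) :
    cutPurity ψ k = ∑ x₁ : QReg N, ∑ x₃ : QReg N,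
      ψ x₁ * star (ψ (rgMerge k x₃ x₁)) * ψ x₃ * star (ψ (rgMerge k x₁ x₃)) := by
  classical
  unfold cutPurity
  refine Finset.sum_congr rfl fun x₁ _ => ?_
  rw [Finset.sum_comm]
  refine Finset.sum_congr rfl fun x₃ _ => ?_
  rw [Finset.sum_eq_single (rgMerge k x₃ x₁)]
  · rw [Finset.sum_eq_single (rgMerge k x₁ x₃)]
    · rw [if_pos]
      exact ⟨fun i hi => (rgMerge_high _ _ hi).symm, fun i hi => rgMerge_low _ _ hi,
        fun i hi => (rgMerge_high _ _ hi).symm, fun i hi => rgMerge_low _ _ hi⟩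
    · intro x₄ _ hne
      rw [if_neg]
      rintro ⟨_, _, h3, h4⟩
      exact hne ((rg_agree₂_iff k x₃ x₄ x₁).1 ⟨h3, h4⟩)
    · intro hn; exact absurd (Finset.mem_univ _) hn
  · intro x₂ _ hne
    refine Finset.sum_eq_zero fun x₄ _ => ?_
    rw [if_neg]
    exact fun H => hne ((rg_agree₂_iff k x₁ x₂ x₃).1 ⟨H.1, H.2.1⟩)
  · intro hn; exact absurd (Finset.mem_univ _) hn

/-- The low-swap `(x₁, x₃) ↦ (rgMerge k x₃ x₁, rgMerge k x₁ x₃)` is an involution of the pairs. -/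
theorem rgMerge_swap_swap (k : ℕ) (x₁ x₃ : QReg N) :
    rgMerge k (rgMerge k x₁ x₃) (rgMerge k x₃ x₁) = x₁ := by
  funext i
  by_cases hi : i.val < k
  · rw [rgMerge_low _ _ hi, rgMerge_low _ _ hi]
  · rw [rgMerge_high _ _ (Nat.le_of_not_lt hi), rgMerge_high _ _ (Nat.le_of_not_lt hi)]

/-- **Purity is at most the fourth power of the norm**: `‖cutPurity ψ k‖ ≤ (Σ_x ‖ψ x‖²)²`
(Cauchy–Schwarz on the 2-fold form, and the low-swap involution). -/
theorem rg_norm_cutPurity_le (ψ : QReg N → ℂ) (k : ℕ) :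
    ‖cutPurity ψ k‖ ≤ (∑ x, ‖ψ x‖ ^ 2) ^ 2 := by
  classical
  rw [rg_cutPurity_eq_two_fold, ← Fintype.sum_prod_type']
  -- |Σ_p A_p B_p| ≤ √(Σ A²) √(Σ B²) with A_p = |ψ x₁||ψ x₃|, B_p = |ψ (m x₃ x₁)||ψ (m x₁ x₃)|
  set A : QReg N × QReg N → ℝ := fun p => ‖ψ p.1‖ * ‖ψ p.2‖ with hA
  set B : QReg N × QReg N → ℝ := fun p => ‖ψ (rgMerge k p.2 p.1)‖ * ‖ψ (rgMerge k p.1 p.2)‖ with hB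
  have h1 : ‖∑ p : QReg N × QReg N, ψ p.1 * star (ψ (rgMerge k p.2 p.1)) * ψ p.2 *
      star (ψ (rgMerge k p.1 p.2))‖ ≤ ∑ p : QReg N × QReg N, A p * B p := by
    refine (norm_sum_le _ _).trans (Finset.sum_le_sum fun p _ => le_of_eq ?_)
    rw [norm_mul, norm_mul, norm_mul, norm_star, norm_star, hA, hB]
    ring
  have h2 : (∑ p : QReg N × QReg N, A p * B p) ^ 2 ≤
      (∑ p : QReg N × QReg N, A p ^ 2) * ∑ p : QReg N × QReg N, B p ^ 2 :=
    Finset.sum_mul_sq_le_sq_mul_sq _ _ _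
  -- Σ A² = (Σ |ψ|²)² and Σ B² = Σ A² by the involution
  have hA2 : ∑ p : QReg N × QReg N, A p ^ 2 = (∑ x, ‖ψ x‖ ^ 2) ^ 2 := by
    rw [hA, Fintype.sum_prod_type, sq (∑ x, ‖ψ x‖ ^ 2), Finset.sum_mul_sum]
    refine Finset.sum_congr rfl fun x₁ _ => Finset.sum_congr rfl fun x₃ _ => ?_
    ring
  let σ : QReg N × QReg N ≃ QReg N × QReg N :=
    { toFun := fun p => (rgMerge k p.2 p.1, rgMerge k p.1 p.2)
      invFun := fun p => (rgMerge k p.2 p.1, rgMerge k p.1 p.2)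
      left_inv := fun p => Prod.ext (rgMerge_swap_swap k p.1 p.2) (rgMerge_swap_swap k p.2 p.1)
      right_inv := fun p => Prod.ext (rgMerge_swap_swap k p.1 p.2) (rgMerge_swap_swap k p.2 p.1) }
  have hB2 : ∑ p : QReg N × QReg N, B p ^ 2 = ∑ p : QReg N × QReg N, A p ^ 2 := by
    rw [hA, hB]
    exact Fintype.sum_equiv σ _ _ (fun p => rfl)
  rw [hB2, hA2] at h2
  have h0 : 0 ≤ (∑ x, ‖ψ x‖ ^ 2) ^ 2 := sq_nonneg _
  exact h1.trans (abs_le_of_sq_le_sq' (by nlinarith [h2]) h0).2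

/-- Purity of a unit vector is at most `1`. -/
theorem rg_norm_cutPurity_le_one {ψ : QReg N → ℂ} (hψ : star ψ ⬝ᵥ ψ = 1) (k : ℕ) :
    ‖cutPurity ψ k‖ ≤ 1 := by
  have h : ∑ x, ‖ψ x‖ ^ 2 = 1 := by
    have h1 : star ψ ⬝ᵥ ψ = ((∑ x, ‖ψ x‖ ^ 2 : ℝ) : ℂ) := by
      simp only [dotProduct, Pi.star_apply, Complex.star_def, Complex.ofReal_sum, Complex.ofReal_pow]
      exact Finset.sum_congr rfl fun x _ => by rw [Complex.conj_mul']
    rw [h1] at hψ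
    exact_mod_cast hψ
  simpa only [h, one_pow] using rg_norm_cutPurity_le ψ k

/-! ## The cube state under diagonal and bit-flipping strings -/

/-- **`X`/`Y`-containing strings are thin on `ĝ`** (APN): `‖⟨ĝ|σ_T|ĝ⟩‖ ≤ 2·(2ⁿ)⁻¹` whenever some
letter of `T` flips a bit. -/
theorem rg_norm_exp_ghat_flip_le (n : ℕ) (K : Type) [Field K] [Fintype K]
    (hK : Fintype.card K = 2 ^ n) (e : K ≃+ (Fin n → ZMod 2)) (T : Fin (n + n) → Pauli)
    (hfl : ∃ j, (T j).flipsBit = true) :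
    ‖star (ghat n K e) ⬝ᵥ (pauliString T *ᵥ ghat n K e)‖ ≤ 2 * ((2 : ℝ) ^ n)⁻¹ := by
  classical
  set g : QReg (n + n) → ℂ := fun w => if (fun j : Fin n => w (Fin.natAdd n j)) =
      (fun j : Fin n => decide (e ((e.symm fun i : Fin n => if w (Fin.castAdd n i) then 1 else 0) ^ 3) j = 1))
      then (1 : ℂ) else 0 with hg
  have hghat : ghat n K e = ((Real.sqrt 2 ^ n)⁻¹ : ℂ) • g := by
    funext w
    simp only [ghat, hg, Pi.smul_apply, smul_eq_mul]
    split_ifs <;> simp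
  have hflat : ‖star g ⬝ᵥ (pauliString T *ᵥ g)‖ ≤ 2 := by
    refine le_trans (norm_indicator_dot_le_card T _) ?_
    exact_mod_cast card_cube_graph_pairs_le_two hK e T hfl
  have hr : (0 : ℝ) < Real.sqrt 2 ^ n := pow_pos (Real.sqrt_pos.2 two_pos) n
  have hs : ‖((Real.sqrt 2 ^ n)⁻¹ : ℂ)‖ = (Real.sqrt 2 ^ n)⁻¹ := by
    rw [norm_inv, norm_pow, Complex.norm_real, Real.norm_of_nonneg (Real.sqrt_nonneg 2)]
  have hr2 : (Real.sqrt 2 ^ n)⁻¹ * (Real.sqrt 2 ^ n)⁻¹ = ((2 : ℝ) ^ n)⁻¹ := by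
    rw [← mul_inv, ← pow_add, ← two_mul, pow_mul, Real.sq_sqrt (by norm_num : (0 : ℝ) ≤ 2)]
  rw [hghat, star_smul, Matrix.mulVec_smul, smul_dotProduct, dotProduct_smul, norm_smul, norm_smul,
    norm_star, hs, ← mul_assoc, hr2, mul_comm]
  exact mul_le_mul_of_nonneg_right hflat (by positivity)

/-- **Every non-identity string is at most near-bent on `ĝ`**: `‖⟨ĝ|σ_T|ĝ⟩‖² ≤ 4·2⁻ⁿ`
(`CubeGraphFlat` and `ĝ = (√2ⁿ)⁻¹ g`). -/
theorem rg_norm_sq_exp_ghat_le (n : ℕ) (K : Type) [Field K] [Fintype K]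
    (hK : Fintype.card K = 2 ^ n) (e : K ≃+ (Fin n → ZMod 2)) (T : Fin (n + n) → Pauli)
    (hT : T ≠ fun _ => Pauli.I) :
    ‖star (ghat n K e) ⬝ᵥ (pauliString T *ᵥ ghat n K e)‖ ^ 2 ≤ 4 * ((2 : ℝ) ^ n)⁻¹ := by
  classical
  set g : QReg (n + n) → ℂ := fun w => if (fun j : Fin n => w (Fin.natAdd n j)) =
      (fun j : Fin n => decide (e ((e.symm fun i : Fin n => if w (Fin.castAdd n i) then 1 else 0) ^ 3) j = 1))
      then (1 : ℂ) else 0 with hg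
  have hghat : ghat n K e = ((Real.sqrt 2 ^ n)⁻¹ : ℂ) • g := by
    funext w
    simp only [ghat, hg, Pi.smul_apply, smul_eq_mul]
    split_ifs <;> simp
  have hflat : ‖star g ⬝ᵥ (pauliString T *ᵥ g)‖ ≤ 2 * Real.sqrt 2 ^ n := cubeGraphFlat_main n K hK e T hT
  have hr : (0 : ℝ) < Real.sqrt 2 ^ n := pow_pos (Real.sqrt_pos.2 two_pos) n
  have hs : ‖((Real.sqrt 2 ^ n)⁻¹ : ℂ)‖ = (Real.sqrt 2 ^ n)⁻¹ := by
    rw [norm_inv, norm_pow, Complex.norm_real, Real.norm_of_nonneg (Real.sqrt_nonneg 2)]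
  have key : ‖star (ghat n K e) ⬝ᵥ (pauliString T *ᵥ ghat n K e)‖ ≤ 2 * (Real.sqrt 2 ^ n)⁻¹ := by
    rw [hghat, star_smul, Matrix.mulVec_smul, smul_dotProduct, dotProduct_smul, norm_smul, norm_smul,
      norm_star, hs]
    calc (Real.sqrt 2 ^ n)⁻¹ * ((Real.sqrt 2 ^ n)⁻¹ * ‖star g ⬝ᵥ (pauliString T *ᵥ g)‖)
        ≤ (Real.sqrt 2 ^ n)⁻¹ * ((Real.sqrt 2 ^ n)⁻¹ * (2 * Real.sqrt 2 ^ n)) :=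
          mul_le_mul_of_nonneg_left (mul_le_mul_of_nonneg_left hflat (inv_nonneg.2 hr.le))
            (inv_nonneg.2 hr.le)
      _ = 2 * (Real.sqrt 2 ^ n)⁻¹ * ((Real.sqrt 2 ^ n)⁻¹ * Real.sqrt 2 ^ n) := by ring
      _ = 2 * (Real.sqrt 2 ^ n)⁻¹ := by rw [inv_mul_cancel₀ hr.ne', mul_one]
  have hr2 : (Real.sqrt 2 ^ n) ^ 2 = 2 ^ n := by
    rw [← pow_mul, mul_comm n 2, pow_mul, Real.sq_sqrt (by norm_num : (0 : ℝ) ≤ 2)]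
  calc ‖star (ghat n K e) ⬝ᵥ (pauliString T *ᵥ ghat n K e)‖ ^ 2 ≤ (2 * (Real.sqrt 2 ^ n)⁻¹) ^ 2 :=
        pow_le_pow_left₀ (norm_nonneg _) key 2
    _ = 4 * ((2 : ℝ) ^ n)⁻¹ := by rw [mul_pow, inv_pow, hr2]; norm_num

/-- A `Z`-type string has expectation exactly `1` in the all-zero basis state. -/
theorem rg_exp_basisState_zero_of_IZ {T : Fin N → Pauli} (hT : ∀ j, T j = Pauli.I ∨ T j = Pauli.Z) :
    star (basisState (fun _ : Fin N => false)) ⬝ᵥ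
        (pauliString T *ᵥ basisState (fun _ : Fin N => false)) = 1 := by
  classical
  have hcol : pauliString T *ᵥ basisState (fun _ : Fin N => false) =
      fun y => pauliString T y (fun _ => false) := by
    funext y
    simp [basisState, Matrix.mulVec, dotProduct, Pi.single_apply]
  rw [hcol]
  simp only [basisState, dotProduct, Pi.star_apply, Pi.single_apply]
  rw [Finset.sum_eq_single (fun _ : Fin N => false)]
  · simp only [if_true, star_one, one_mul, pauliString_eq, tensorAll_apply]
    refine Finset.prod_eq_one fun j _ => ?_
    rcases hT j with h | h <;> simp [h, Pauli.mat]
  · intro y _ hy; simp [hy]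
  · intro h; exact absurd (Finset.mem_univ _) h

/-! ## The isotropic count through a stabilizer state -/

section Count

variable {V : Matrix (QReg N) (QReg N) ℂ} {f : (Fin N → Pauli) → (Fin N → Pauli)}
  {c : (Fin N → Pauli) → ℂ}

/-- **At most `2^k` `Z`-type strings pull back into the cut**: for a Clifford unitary `V` with label
map `f` and every `k ≤ N`, the `Z`-type strings `T` with `f T ∈ 𝒫^{<k} ⊗ I` number at most `2^k`
(isotropy of the pulled-back cut space against the `Z`-Lagrangian, read through the stabilizer state
`V e₀`: its cut purity is at most `1`). -/
theorem rg_card_IZ_preimage_le (hU : Vᴴ * V = 1)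
    (hf : ∀ S, ‖c S‖ = 1 ∧ V * pauliString S * Vᴴ = c S • pauliString (f S)) {k : ℕ} (hk : k ≤ N) :
    ((Finset.univ.filter fun T : Fin N → Pauli => (∀ j, T j = Pauli.I ∨ T j = Pauli.Z) ∧
        f T ∈ stringsOn (Finset.univ.filter fun i : Fin N => i.val < k)).card : ℝ) ≤ (2 : ℝ) ^ k := by
  classical
  set e₀ : QReg N → ℂ := basisState (fun _ : Fin N => false) with he₀
  -- pulled-back mass of V e₀ on the cut
  have hmass : ∑ Q ∈ stringsOn (Finset.univ.filter fun i : Fin N => i.val < k),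
      ‖star (V *ᵥ e₀) ⬝ᵥ (pauliString Q *ᵥ (V *ᵥ e₀))‖ ^ 2 ≤ (2 : ℝ) ^ k := by
    have h1 := gdb_norm_cutSum_eq (V *ᵥ e₀) hk
    have hunit : star (V *ᵥ e₀) ⬝ᵥ (V *ᵥ e₀) = 1 := by
      rw [star_mulVec_dotProduct_mulVec hU, he₀]
      simp [basisState, dotProduct, Pi.single_apply]
    have hp : ‖cutPurity (V *ᵥ e₀) k‖ ≤ 1 := rg_norm_cutPurity_le_one hunit k
    rw [cutPurity] at hp
    rw [h1] at hp
    have h2k : (0 : ℝ) < 2 ^ k := pow_pos two_pos k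
    rw [inv_mul_le_iff₀ h2k, mul_one] at hp
    exact hp
  rw [sum_stringsOn_norm_exp_sq_clifford hU hf e₀] at hmass
  -- the Z-type subfamily contributes 1 per member
  refine le_trans ?_ hmass
  rw [← Finset.sum_filter_add_sum_filter_not _ (fun T : Fin N → Pauli => ∀ j, T j = Pauli.I ∨ T j = Pauli.Z)]
  have hsub : (Finset.univ.filter fun T : Fin N → Pauli => (∀ j, T j = Pauli.I ∨ T j = Pauli.Z) ∧
      f T ∈ stringsOn (Finset.univ.filter fun i : Fin N => i.val < k)) =
      (Finset.univ.filter fun T : Fin N → Pauli =>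
        f T ∈ stringsOn (Finset.univ.filter fun i : Fin N => i.val < k)).filter
        fun T => ∀ j, T j = Pauli.I ∨ T j = Pauli.Z := by
    ext T; simp [and_comm]
  rw [hsub]
  have hone : ∀ T ∈ (Finset.univ.filter fun T : Fin N → Pauli =>
        f T ∈ stringsOn (Finset.univ.filter fun i : Fin N => i.val < k)).filter
        (fun T => ∀ j, T j = Pauli.I ∨ T j = Pauli.Z),
      ‖star e₀ ⬝ᵥ (pauliString T *ᵥ e₀)‖ ^ 2 = 1 := by
    intro T hT
    rw [Finset.mem_filter] at hT
    rw [he₀, rg_exp_basisState_zero_of_IZ hT.2, norm_one, one_pow]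
  rw [Finset.card_eq_sum_ones, Nat.cast_sum, Nat.cast_one, ← Finset.sum_congr rfl hone]
  have hnn : 0 ≤ ∑ T ∈ (Finset.univ.filter fun T : Fin N → Pauli =>
        f T ∈ stringsOn (Finset.univ.filter fun i : Fin N => i.val < k)).filter
        (fun T => ¬ ∀ j, T j = Pauli.I ∨ T j = Pauli.Z),
      ‖star e₀ ⬝ᵥ (pauliString T *ᵥ e₀)‖ ^ 2 := Finset.sum_nonneg fun _ _ => sq_nonneg _
  linarith

/-- The pulled-back family has at most `4^k` members. -/
theorem rg_card_preimage_le (hU : Vᴴ * V = 1)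
    (hf : ∀ S, ‖c S‖ = 1 ∧ V * pauliString S * Vᴴ = c S • pauliString (f S)) {k : ℕ} (hk : k ≤ N) :
    ((Finset.univ.filter fun T : Fin N → Pauli =>
        f T ∈ stringsOn (Finset.univ.filter fun i : Fin N => i.val < k)).card : ℝ) ≤ (4 : ℝ) ^ k := by
  classical
  have hinj := clifford_injective hU hf
  have h1 : (Finset.univ.filter fun T : Fin N → Pauli =>
      f T ∈ stringsOn (Finset.univ.filter fun i : Fin N => i.val < k)).card ≤
      (stringsOn (Finset.univ.filter fun i : Fin N => i.val < k)).card := by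
    refine Finset.card_le_card_of_injOn f (fun T hT => ?_) (fun T₁ _ T₂ _ h => hinj h)
    rw [Finset.mem_coe, Finset.mem_filter] at hT
    exact hT.2
  rw [card_stringsOn, gdb_card_filter_lt hk] at h1
  exact_mod_cast h1

end Count

/-! ## Rigidity -/

/-- **Depth-1 rigidity of the cube state** (crux stmt-QuantumAdvantage-10730, line `Sketch`,
ingredient (R) of the torus theorem; refuter gen-2's Disproof §6.1).  For every Clifford unitary `V`
on the `2n` wires and every cut `k ≤ 2n`:
`‖Tr ρ²_{wires<k}(V ĝ)‖ ≤ 2^{-k} + 4·2^{-n} + 4·2^k·4^{-n}` — at the middle cut `k = n` this is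
`9·2^{-n}`: every linear cut of every Clifford image of `ĝ` is near-maximally entangled. -/
theorem rg_norm_cutPurity_clifford_ghat_le (n : ℕ) (K : Type) [Field K] [Fintype K]
    (hK : Fintype.card K = 2 ^ n) (e : K ≃+ (Fin n → ZMod 2))
    {V : Matrix (QReg (n + n)) (QReg (n + n)) ℂ} (hu : V ∈ Matrix.unitaryGroup (QReg (n + n)) ℂ)
    (hc : IsCliffordU V) {k : ℕ} (hk : k ≤ n + n) :
    ‖cutPurity (V *ᵥ ghat n K e) k‖ ≤
      ((2 : ℝ) ^ k)⁻¹ + 4 * ((2 : ℝ) ^ n)⁻¹ + 4 * (2 : ℝ) ^ k * ((4 : ℝ) ^ n)⁻¹ := by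
  classical
  choose f c hcf hf using hc
  have hf' : ∀ S, ‖c S‖ = 1 ∧ V * pauliString S * Vᴴ = c S • pauliString (f S) :=
    fun S => ⟨hcf S, by rw [← Matrix.star_eq_conjTranspose]; exact hf S⟩
  have hU : Vᴴ * V = 1 := by
    rw [← Matrix.star_eq_conjTranspose]; exact Matrix.mem_unitaryGroup_iff'.1 hu
  -- purity = 2^{-k} · pulled-back mass
  rw [cutPurity, gdb_norm_cutSum_eq _ hk, sum_stringsOn_norm_exp_sq_clifford hU hf' (ghat n K e)]
  set F := Finset.univ.filter fun T : Fin (n + n) → Pauli =>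
    f T ∈ stringsOn (Finset.univ.filter fun i : Fin (n + n) => i.val < k) with hF
  set m : (Fin (n + n) → Pauli) → ℝ := fun T =>
    ‖star (ghat n K e) ⬝ᵥ (pauliString T *ᵥ ghat n K e)‖ ^ 2 with hm
  -- split F into Z-type and flipping strings
  have split := (Finset.sum_filter_add_sum_filter_not F
    (fun T : Fin (n + n) → Pauli => ∀ j, T j = Pauli.I ∨ T j = Pauli.Z) m).symm
  -- Z-type part: ≤ 1 + (#Z-type) · 4·2⁻ⁿ ≤ 1 + 2^k · 4·2⁻ⁿ
  have hZ : ∑ T ∈ F.filter (fun T => ∀ j, T j = Pauli.I ∨ T j = Pauli.Z), m T ≤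
      1 + (2 : ℝ) ^ k * (4 * ((2 : ℝ) ^ n)⁻¹) := by
    have each : ∀ T ∈ F.filter (fun T => ∀ j, T j = Pauli.I ∨ T j = Pauli.Z),
        m T ≤ (if T = fun _ => Pauli.I then 1 else 0) + 4 * ((2 : ℝ) ^ n)⁻¹ := by
      intro T _
      by_cases hT : T = fun _ => Pauli.I
      · rw [if_pos hT, hm]
        subst hT
        simp only [pauliString_const_I, Matrix.one_mulVec, star_ghat_dotProduct_ghat, norm_one, one_pow]
        have : 0 ≤ 4 * ((2 : ℝ) ^ n)⁻¹ := by positivity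
        linarith
      · rw [if_neg hT, zero_add]
        exact rg_norm_sq_exp_ghat_le n K hK e T hT
    refine (Finset.sum_le_sum each).trans ?_
    rw [Finset.sum_add_distrib, Finset.sum_const, nsmul_eq_mul]
    have hI : ∑ T ∈ F.filter (fun T => ∀ j, T j = Pauli.I ∨ T j = Pauli.Z),
        (if T = fun _ => Pauli.I then (1 : ℝ) else 0) ≤ 1 := by
      rw [Finset.sum_ite, Finset.sum_const_zero, add_zero, Finset.sum_const, nsmul_eq_mul, mul_one]
      have : ((F.filter (fun T => ∀ j, T j = Pauli.I ∨ T j = Pauli.Z)).filter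
          (fun T => T = fun _ => Pauli.I)).card ≤ 1 := by
        rw [Finset.card_le_one]
        intro a ha b hb
        rw [Finset.mem_filter] at ha hb
        rw [ha.2, hb.2]
      exact_mod_cast this
    have hcard : ((F.filter (fun T => ∀ j, T j = Pauli.I ∨ T j = Pauli.Z)).card : ℝ) ≤ (2 : ℝ) ^ k := by
      have := rg_card_IZ_preimage_le hU hf' hk
      have heq : (Finset.univ.filter fun T : Fin (n + n) → Pauli => (∀ j, T j = Pauli.I ∨ T j = Pauli.Z) ∧
          f T ∈ stringsOn (Finset.univ.filter fun i : Fin (n + n) => i.val < k)) =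
          F.filter (fun T => ∀ j, T j = Pauli.I ∨ T j = Pauli.Z) := by
        ext T; simp [hF, and_comm]
      rw [heq] at this
      exact this
    nlinarith [hcard, show 0 ≤ 4 * ((2 : ℝ) ^ n)⁻¹ by positivity]
  -- flipping part: ≤ 4^k · 4·4⁻ⁿ
  have hX : ∑ T ∈ F.filter (fun T => ¬ ∀ j, T j = Pauli.I ∨ T j = Pauli.Z), m T ≤
      (4 : ℝ) ^ k * (4 * ((4 : ℝ) ^ n)⁻¹) := by
    have each : ∀ T ∈ F.filter (fun T => ¬ ∀ j, T j = Pauli.I ∨ T j = Pauli.Z),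
        m T ≤ 4 * ((4 : ℝ) ^ n)⁻¹ := by
      intro T hT
      rw [Finset.mem_filter] at hT
      have hfl : ∃ j, (T j).flipsBit = true := by
        by_contra hno
        push Not at hno
        exact hT.2 fun j => eq_I_or_eq_Z_of_flipsBit (Bool.eq_false_iff.mpr (hno j))
      have h := rg_norm_exp_ghat_flip_le n K hK e T hfl
      have h4 : (4 : ℝ) ^ n = (2 ^ n) ^ 2 := by rw [← pow_mul, mul_comm, pow_mul]; norm_num
      calc m T ≤ (2 * ((2 : ℝ) ^ n)⁻¹) ^ 2 := pow_le_pow_left₀ (norm_nonneg _) h 2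
        _ = 4 * ((4 : ℝ) ^ n)⁻¹ := by rw [h4, mul_pow, inv_pow]; norm_num
    refine (Finset.sum_le_sum each).trans ?_
    rw [Finset.sum_const, nsmul_eq_mul]
    apply mul_le_mul_of_nonneg_right _ (by positivity)
    exact le_trans (by exact_mod_cast Finset.card_filter_le _ _) (rg_card_preimage_le hU hf' hk)
  rw [split]
  have h2k : (0 : ℝ) < 2 ^ k := pow_pos two_pos k
  calc ((2 : ℝ) ^ k)⁻¹ * (∑ T ∈ F.filter (fun T => ∀ j, T j = Pauli.I ∨ T j = Pauli.Z), m T +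
        ∑ T ∈ F.filter (fun T => ¬ ∀ j, T j = Pauli.I ∨ T j = Pauli.Z), m T)
      ≤ ((2 : ℝ) ^ k)⁻¹ * ((1 + (2 : ℝ) ^ k * (4 * ((2 : ℝ) ^ n)⁻¹)) + (4 : ℝ) ^ k * (4 * ((4 : ℝ) ^ n)⁻¹)) :=
        mul_le_mul_of_nonneg_left (add_le_add hZ hX) (by positivity)
    _ = ((2 : ℝ) ^ k)⁻¹ + 4 * ((2 : ℝ) ^ n)⁻¹ + 4 * (2 : ℝ) ^ k * ((4 : ℝ) ^ n)⁻¹ := by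
        have h4 : (4 : ℝ) ^ k = 2 ^ k * 2 ^ k := by rw [← mul_pow]; norm_num
        rw [h4]
        field_simp

/-- **Registered sub-goal `rg_rigidity`** (crux stmt-QuantumAdvantage-10730, line `Sketch`,
ingredient (R) of the torus theorem): depth-1 rigidity of the cube state, closed form. -/
theorem rg_rigidity :
    ∀ (n : ℕ) (K : Type) [Field K] [Fintype K], Fintype.card K = 2 ^ n → ∀ e : K ≃+ (Fin n → ZMod 2),
      ∀ V : Matrix (QReg (n + n)) (QReg (n + n)) ℂ, V ∈ Matrix.unitaryGroup (QReg (n + n)) ℂ →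
      IsCliffordU V → ∀ k ≤ n + n, ‖cutPurity (V *ᵥ ghat n K e) k‖ ≤
        ((2 : ℝ) ^ k)⁻¹ + 4 * ((2 : ℝ) ^ n)⁻¹ + 4 * (2 : ℝ) ^ k * ((4 : ℝ) ^ n)⁻¹ :=
  fun n K _ _ hK e _ hu hc _ hk => rg_norm_cutPurity_clifford_ghat_le n K hK e hu hc hk

end Summit.QuantumAdvantage.QuantumAdvantage.Theorems.SymplecticPurity.CompositeFrameBound

end
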